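/-
HONEST FRAMING: certified error envelopes and provably optimal rounding/accumulation schemes for
low-precision formats under stated cost models; every table by two implementations; no hardware
or vendor claims.
-/
import Summits.Ventures.CertifiedArithmetic.LowPrec.OptDemotionBudgetMono

/-!
# The demotion law (Theorem T8), part 7b′: the RELAXATION THEOREM `exact ≤ Φ*`

OPTIMA.md §B T8(b)(iii′)(R1) as a Lean theorem (`exact_le_phi`): in `F(q, emin)` with ANY nearest
rounding, a summation tree of nonnegative floats computing `v > 0` has
`exact ≤ 2^(⌊log₂ v⌋+1-q) · Φ*_(shape)(mant v)` (`v = mant v · 2^(⌊log₂ v⌋+1-q)`, `float_canon`), and a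
tree computing `0` sums to `≤ 0`.  Node step: the children compute floats `a, b ≤ v` with
`a + b ≤ v + ½ulp(v)` (`round_sum_facts`), each child is read at the parent's scale (`child_scale`),
a left child deeper than `q+1` binades is lifted to depth `q+1`, and the right child is dominated by
`bmax` through `phiVal_mono`.  No hypothesis on the tree; gradual underflow included.
-/

namespace Summit.Ventures.CertifiedArithmetic.LowPrec.Opt

open Literature.ComputerArithmetic.JeannerodRump2018
open Literature.ComputerArithmetic.JeannerodRump2018.SumTree

/-! ## `exact ≤ Φ*` (part 7b, §2)

The RELAXATION THEOREM (OPTIMA (iii′)(R1)): in `F(q, emin)` with ANY nearest rounding `fl`, every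
summation tree of nonnegative floats computing `v = m · 2^(⌊log₂ v⌋ + 1 - q)` (`m` its mantissa) has
exact sum at most `2^(⌊log₂ v⌋ + 1 - q) · Φ*_(shape)(m)`; and a tree computing `0` has exact sum `0`. -/

/-- A positive float of `F(q, emin)` is its mantissa times `2^(⌊log₂ v⌋ + 1 - q)`, the mantissa lying
in `[2^(q-1), 2^q)`. -/
theorem float_canon {q : ℕ} (hq : 1 ≤ q) {emin : ℤ} {v : ℚ} (hv : IsFloat q emin v) (hpos : 0 < v) :
    v = (mant q v : ℚ) * (2 : ℚ) ^ (Int.log 2 v + 1 - q) ∧ 2 ^ (q - 1) ≤ mant q v ∧ mant q v < 2 ^ q := by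
  have h2 : (2 : ℚ) ≠ 0 := by norm_num
  set K := Int.log 2 v with hK
  have hvlo : ((2 : ℕ) : ℚ) ^ K ≤ v := Int.zpow_log_le_self (by norm_num) hpos
  have hvhi : v < ((2 : ℕ) : ℚ) ^ (K + 1) := Int.lt_zpow_succ_log_self (by norm_num) v
  push_cast at hvlo hvhi
  obtain ⟨N, hN⟩ := isFloat_grid hv hvlo
  set g := (2 : ℚ) ^ (K + 1 - q) with hg
  have hgpos : 0 < g := zpow_pos (by norm_num) _
  have hKg : (2 : ℚ) ^ K = (2 : ℚ) ^ (q - 1) * g := by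
    rw [hg, ← zpow_natCast, ← zpow_add₀ h2]; congr 1; push_cast [Nat.cast_sub hq]; ring
  have hK1g : (2 : ℚ) ^ (K + 1) = (2 : ℚ) ^ q * g := by
    rw [hg, ← zpow_natCast, ← zpow_add₀ h2]; congr 1; ring
  have hNlo : ((2 ^ (q - 1) : ℕ) : ℚ) ≤ (N : ℚ) := by
    have h1 : (2 : ℚ) ^ (q - 1) * g ≤ (N : ℚ) * g := by rw [← hKg, ← hN]; exact hvlo
    push_cast; exact le_of_mul_le_mul_right h1 hgpos
  have hNhi : (N : ℚ) < ((2 ^ q : ℕ) : ℚ) := by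
    have h1 : (N : ℚ) * g < (2 : ℚ) ^ q * g := by rw [← hK1g, ← hN]; exact hvhi
    push_cast; exact lt_of_mul_lt_mul_right h1 hgpos.le
  have hN0 : (0 : ℤ) ≤ N := by
    have : (0 : ℚ) ≤ N := le_trans (by positivity) hNlo
    exact_mod_cast this
  obtain ⟨M, rfl⟩ : ∃ M : ℕ, N = M := ⟨N.toNat, (Int.toNat_of_nonneg hN0).symm⟩
  have hmant : mant q v = M := by
    unfold mant
    rw [← hK, ← hg, hN, mul_div_assoc, div_self hgpos.ne', mul_one]
    push_cast
    rw [Int.floor_natCast]; rfl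
  rw [hmant]
  push_cast at hNlo hNhi hN
  exact ⟨hN, by exact_mod_cast hNlo, by exact_mod_cast hNhi⟩

/-- `Int.log 2` is monotone on positive rationals bounded by a binade: `0 < w ≤ v < 2^(K+1) ⟹ log₂ w ≤ K`. -/
theorem int_log_le_of_lt {w : ℚ} (hw : 0 < w) {K : ℤ} (hlt : w < (2 : ℚ) ^ (K + 1)) : Int.log 2 w ≤ K := by
  have h1 : ((2 : ℕ) : ℚ) ^ (Int.log 2 w) ≤ w := Int.zpow_log_le_self (by norm_num) hw
  push_cast at h1
  by_contra hc
  have : (2 : ℚ) ^ (K + 1) ≤ (2 : ℚ) ^ (Int.log 2 w) := zpow_le_zpow_right₀ (by norm_num) (by omega)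
  linarith

section Sound

variable {q : ℕ} {emin : ℤ} {fl : ℚ → ℚ}

/-- A CHILD READ AT THE PARENT'S SCALE: a positive float `w ≤ v` (`v` positive with
`⌊log₂ v⌋ = K`) is the grid value `mant w / 2^j` at the scale `g = 2^(K+1-q)` of `v`, with
`j = K - ⌊log₂ w⌋ ∈ ℕ`:  `w = g · (mant w / 2^j)` and `2^(⌊log₂ w⌋+1-q) = g / 2^j`. -/
theorem child_scale (hq : 1 ≤ q) {w : ℚ} (hw : IsFloat q emin w) (hpos : 0 < w) {K : ℤ}
    (hlt : w < (2 : ℚ) ^ (K + 1)) :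
    (2 : ℚ) ^ (Int.log 2 w + 1 - q) = (2 : ℚ) ^ (K + 1 - q) / 2 ^ (K - Int.log 2 w).toNat ∧
    w = (2 : ℚ) ^ (K + 1 - q) * ((mant q w : ℚ) / 2 ^ (K - Int.log 2 w).toNat) := by
  have h2 : (2 : ℚ) ≠ 0 := by norm_num
  have hle : Int.log 2 w ≤ K := int_log_le_of_lt hpos hlt
  obtain ⟨hcan, -, -⟩ := float_canon hq hw hpos
  have hj : ((K - Int.log 2 w).toNat : ℤ) = K - Int.log 2 w := Int.toNat_of_nonneg (by omega)
  have e1 : (2 : ℚ) ^ (Int.log 2 w + 1 - q) = (2 : ℚ) ^ (K + 1 - q) / 2 ^ (K - Int.log 2 w).toNat := by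
    rw [← zpow_natCast, hj, ← zpow_sub₀ h2]; congr 1; ring
  refine ⟨e1, ?_⟩
  rw [mul_div_assoc', mul_comm, ← mul_div_assoc', ← e1, ← hcan]

/-- **THE RELAXATION THEOREM `exact ≤ Φ*`** (OPTIMA T8(b)(iii′)(R1)).  `q ≥ 1`, `fl` ANY nearest
rounding into `F(q, emin)`, `t` a summation tree of nonnegative floats of `F(q, emin)` computing `v`.
If `v = 0` the exact sum is `≤ 0`; if `v > 0`, with `v = m · 2^(⌊log₂ v⌋+1-q)`,
`exact(t) ≤ 2^(⌊log₂ v⌋+1-q) · Φ*_(shape t)(m)`.  (Gradual underflow only makes additions exact; the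
node step of `Φ*` holds by construction: the children compute floats `a, b ≤ v` with
`a + b ≤ v + u·ufp(v)`, and `Φ*` is monotone.) -/
theorem exact_le_phi (hq : 1 ≤ q) (hfl : IsRoundNearest q emin fl) :
    ∀ t : SumTree, (∀ x ∈ leaves t, IsFloat q emin x ∧ 0 ≤ x) →
      (eval fl t = 0 → exact t ≤ 0) ∧
      (0 < eval fl t → exact t ≤
        (2 : ℚ) ^ (Int.log 2 (eval fl t) + 1 - q) * phi q (shapeOf t) (mant q (eval fl t)))
  | .leaf x, h => by
      refine ⟨fun h0 => by simpa [eval, exact] using h0.le, fun hpos => ?_⟩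
      simp only [eval, exact, shapeOf_leaf] at hpos ⊢
      obtain ⟨hxF, -⟩ := h x (by simp [leaves])
      obtain ⟨hcan, hm, hm'⟩ := float_canon hq hxF hpos
      rw [phi_lf hm hm' hq, mul_comm, ← hcan]
  | .node a b, h => by
      have hu0 := unitRoundoff_nonneg q
      have hla : ∀ x ∈ leaves a, IsFloat q emin x ∧ 0 ≤ x := fun x hx => h x (by simp [leaves, hx])
      have hlb : ∀ x ∈ leaves b, IsFloat q emin x ∧ 0 ≤ x := fun x hx => h x (by simp [leaves, hx])
      obtain ⟨iha0, iha⟩ := exact_le_phi hq hfl a hla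
      obtain ⟨ihb0, ihb⟩ := exact_le_phi hq hfl b hlb
      obtain ⟨haF, ha0⟩ := eval_isFloat_nonneg hfl a hla
      obtain ⟨hbF, hb0⟩ := eval_isFloat_nonneg hfl b hlb
      have hva_le : eval fl a ≤ eval fl (.node a b) :=
        le_fl_of_isFloat_le hfl haF (le_add_of_nonneg_right hb0)
      have hvb_le : eval fl b ≤ eval fl (.node a b) := by
        simp only [eval]
        exact le_fl_of_isFloat_le hfl hbF (le_add_of_nonneg_left ha0)
      refine ⟨fun h0 => ?_, fun hpos => ?_⟩
      · have ha' : eval fl a = 0 := le_antisymm (h0 ▸ hva_le) ha0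
        have hb' : eval fl b = 0 := le_antisymm (h0 ▸ hvb_le) hb0
        simp only [exact]; linarith [iha0 ha', ihb0 hb']
      · set v := eval fl (.node a b) with hv
        have hvdef : v = fl (eval fl a + eval fl b) := rfl
        obtain ⟨hvF, -⟩ := eval_isFloat_nonneg hfl (.node a b) h
        set K := Int.log 2 v with hK
        have hvlo : ((2 : ℕ) : ℚ) ^ K ≤ v := Int.zpow_log_le_self (by norm_num) hpos
        have hvhi : v < ((2 : ℕ) : ℚ) ^ (K + 1) := Int.lt_zpow_succ_log_self (by norm_num) v
        push_cast at hvlo hvhi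
        obtain ⟨hvcan, hm, hm'⟩ := float_canon hq hvF hpos
        set m := mant q v with hmdef
        set g := (2 : ℚ) ^ (K + 1 - q) with hg
        have hgpos : 0 < g := zpow_pos (by norm_num) _
        -- the sum of the children is at most v + g/2
        have hsum : eval fl a + eval fl b ≤ v + g / 2 := by
          obtain ⟨habs, -⟩ := round_sum_facts hq hfl haF hbF ha0 hb0 (K := K) (by rw [← hvdef]; exact hvhi)
          have h1 := (abs_le.mp habs).2
          have hug : unitRoundoff q * (2 : ℚ) ^ K = g / 2 := by
            rw [(u_mul_zpow q K).1, hg, show K - (q : ℤ) = (K + 1 - q) - 1 by ring, zpow_sub_one₀ (by norm_num)]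
            ring
          rw [← hvdef] at h1; linarith
        rw [shapeOf_node, phi_nd hm hm' hq]
        simp only [exact]
        -- the right child bound through any grid value it is below
        have hB : ∀ {n k : ℕ}, 2 ^ (q - 1) ≤ n → n < 2 ^ q → eval fl b ≤ g * ((n : ℚ) / 2 ^ k) →
            exact b ≤ g * phiVal q (shapeOf b) n k := by
          intro n k hn hn' hle
          rcases eq_or_lt_of_le hb0 with hb00 | hbpos
          · exact le_trans (ihb0 hb00.symm) (mul_nonneg hgpos.le (phiVal_nonneg q _ n k))
          · obtain ⟨e1, e2⟩ := child_scale hq hbF hbpos (lt_of_le_of_lt hvb_le hvhi)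
            obtain ⟨-, hnb, hnb'⟩ := float_canon hq hbF hbpos
            have h3 := ihb hbpos
            rw [e1] at h3
            -- exact b ≤ g * phiVal b (mant b) jb ≤ g * phiVal b n k
            refine le_trans h3 ?_
            rw [div_mul_eq_mul_div, mul_div_assoc]
            refine mul_le_mul_of_nonneg_left ?_ hgpos.le
            refine phiVal_mono hq (shapeOf b) hnb hnb' hn hn' ?_
            rw [e2] at hle
            exact le_of_mul_le_mul_left hle hgpos
        rcases eq_or_lt_of_le ha0 with ha00 | hapos
        · -- left child zero: v = fl(v_b) = v_b, the `a = 0` term covers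
          have hea : exact a ≤ 0 := iha0 ha00.symm
          have hvb : v = eval fl b := by rw [hvdef, ← ha00, zero_add, fl_eq_self hfl hbF]
          have h1 : exact b ≤ g * phiVal q (shapeOf b) m 0 :=
            hB hm hm' (by rw [← hvb, hv, hvcan, pow_zero, div_one, mul_comm])
          calc exact a + exact b ≤ 0 + g * phiVal q (shapeOf b) m 0 := add_le_add hea h1
            _ = g * gval q (phiTab q (shapeOf b)) m 0 := by rw [gval_phiTab]; ring
            _ ≤ g * nodeEntry q (phiTab q (shapeOf a)) (phiTab q (shapeOf b)) m :=
                mul_le_mul_of_nonneg_left (init_le_candMax q _ _ m _) hgpos.le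
        · -- left child positive: the grid value (ma, ja)
          obtain ⟨e1, e2⟩ := child_scale hq haF hapos (lt_of_le_of_lt hva_le hvhi)
          obtain ⟨-, hma, hma'⟩ := float_canon hq haF hapos
          set ma := mant q (eval fl a) with hmadef
          set ja := (K - Int.log 2 (eval fl a)).toNat with hjadef
          have hA : exact a ≤ g * phiVal q (shapeOf a) ma ja := by
            have h3 := iha hapos
            rw [e1] at h3
            refine le_trans h3 (le_of_eq ?_)
            unfold phiVal; ring
          -- a ≤ m and a + b-value ≤ m + 1/2 at the scale g
          have hale : (ma : ℚ) / 2 ^ ja ≤ m := by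
            have : g * ((ma : ℚ) / 2 ^ ja) ≤ g * m := by rw [← e2, mul_comm, ← hvcan]; exact hva_le
            exact le_of_mul_le_mul_left this hgpos
          by_cases hja : ja ≤ q + 1
          · have hmem : (ma, ja) ∈ cands q := mem_cands hma hma' hja hq
            have hok : candOK q m (ma, ja) = true := (candOK_iff_rat (by exact hja)).mpr hale
            obtain ⟨hmb, hmb', -, -, hmax⟩ := bmax_spec hq hm hm' hma' hja hale
            set mb := (bmax q m (ma * 2 ^ (q + 1 - ja))).1 with hmbdef
            set jb := (bmax q m (ma * 2 ^ (q + 1 - ja))).2 with hjbdef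
            -- the right child is below bmax
            have hBle : exact b ≤ g * phiVal q (shapeOf b) mb jb := by
              rcases eq_or_lt_of_le hb0 with hb00 | hbpos
              · exact le_trans (ihb0 hb00.symm) (mul_nonneg hgpos.le (phiVal_nonneg q _ mb jb))
              · obtain ⟨f1, f2⟩ := child_scale hq hbF hbpos (lt_of_le_of_lt hvb_le hvhi)
                obtain ⟨-, hnb, hnb'⟩ := float_canon hq hbF hbpos
                set nb := mant q (eval fl b)
                set kb := (K - Int.log 2 (eval fl b)).toNat
                have hnble : (nb : ℚ) / 2 ^ kb ≤ m := by
                  have : g * ((nb : ℚ) / 2 ^ kb) ≤ g * m := by rw [← f2, mul_comm, ← hvcan]; exact hvb_le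
                  exact le_of_mul_le_mul_left this hgpos
                have hnbsum : (nb : ℚ) / 2 ^ kb + (ma : ℚ) / 2 ^ ja ≤ m + 1 / 2 := by
                  have : g * ((nb : ℚ) / 2 ^ kb + (ma : ℚ) / 2 ^ ja) ≤ g * (m + 1 / 2) := by
                    rw [mul_add, ← f2, ← e2, mul_add, mul_comm g (m : ℚ), ← hvcan]
                    linarith
                  exact le_of_mul_le_mul_left this hgpos
                exact hB hmb hmb' (by
                  rw [f2]
                  exact mul_le_mul_of_nonneg_left (hmax nb kb hnb hnb' hnble hnbsum) hgpos.le)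
            calc exact a + exact b
                ≤ g * phiVal q (shapeOf a) ma ja + g * phiVal q (shapeOf b) mb jb := add_le_add hA hBle
              _ = g * candTerm q (phiTab q (shapeOf a)) (phiTab q (shapeOf b)) m (ma, ja) := by
                  rw [candTerm_eq]; simp only [← hmbdef, ← hjbdef]; ring
              _ ≤ g * nodeEntry q (phiTab q (shapeOf a)) (phiTab q (shapeOf b)) m :=
                  mul_le_mul_of_nonneg_left (term_le_candMax q _ _ m _ _ hmem hok) hgpos.le
          · -- a deeper than q+1: lift it to depth q+1; the right child gets the whole budget
            rw [not_le] at hja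
            have hmem : (ma, q + 1) ∈ cands q := mem_cands hma hma' le_rfl hq
            have hok : candOK q m (ma, q + 1) = true := by
              rw [candOK_iff]
              simp only [Nat.sub_self, pow_zero, mul_one]
              have h1 : 1 ≤ m := le_trans Nat.one_le_two_pow hm
              calc ma ≤ 2 ^ q := hma'.le
                _ ≤ 2 ^ (q + 1) := Nat.pow_le_pow_right (by norm_num) (by omega)
                _ ≤ m * 2 ^ (q + 1) := Nat.le_mul_of_pos_left _ h1
            have hsmallA : ma * 2 ^ (q + 1 - (q + 1)) ≤ 2 ^ q := by simp; omega
            have hA' : exact a ≤ g * phiVal q (shapeOf a) ma (q + 1) :=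
              le_trans hA (mul_le_mul_of_nonneg_left (phiVal_depth_antitone q _ ma hja.le) hgpos.le)
            have hBle : exact b ≤ g * phiVal q (shapeOf b) m 0 :=
              hB hm hm' (by rw [pow_zero, div_one, mul_comm, ← hvcan]; exact hvb_le)
            calc exact a + exact b
                ≤ g * phiVal q (shapeOf a) ma (q + 1) + g * phiVal q (shapeOf b) m 0 := add_le_add hA' hBle
              _ = g * candTerm q (phiTab q (shapeOf a)) (phiTab q (shapeOf b)) m (ma, q + 1) := by
                  rw [candTerm_eq]; simp only [bmax_small hsmallA]; ring
              _ ≤ g * nodeEntry q (phiTab q (shapeOf a)) (phiTab q (shapeOf b)) m :=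
                  mul_le_mul_of_nonneg_left (term_le_candMax q _ _ m _ _ hmem hok) hgpos.le

end Sound

end Summit.Ventures.CertifiedArithmetic.LowPrec.Opt
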